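import Mathlib.Analysis.SpecialFunctions.Pow.Real
import Literature.Computability.AlgebraicComplexity.StandardFamilies
import HarnessLib

/-!
# Named fact: `2^{Ω(√n)}` lower bound for `per_n`, `det_n` against `ΣΠ^{[O(√n)]}ΣΠ^{[√n]}`
circuits (Gupta–Kamath–Kayal–Saptharishi 2014)

Trunk T-CPLX-ALG; cite item `wi-03854` (route ValiantsHypothesis/Depth4, known regime under
cruxes 0330/0331).

**Gupta–Kamath–Kayal–Saptharishi, J. ACM 61(6) (2014), Thm. 1** (CCC 2013): over a field of
characteristic `0`, any `ΣΠ^{[O(√n)]}ΣΠ^{[√n]}` circuit computing `per_n` or `det_n` — i.e. any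
expression `Σ_{i ≤ s} ∏_{j ≤ D} Q_{ij}` with `deg Q_{ij} ≤ √n` (bottom fan-in) and `D = O(√n)` (top
product fan-in) — has top fan-in `s ≥ 2^{Ω(√n)}` (hence size `2^{Ω(√n)}`). Improved to
`n^{Ω(√n)}` for bounded bottom fan-in by Kayal–Saha–Saptharishi 2014.

Rendering: SEMANTIC (no circuit data structure needed, and none with per-level fan-in exists in
the tree): "`f = Σ_{i<s} ∏_{j<D} Q i j` with `deg (Q i j) ≤ ⌊√n⌋` and `D ≤ c₀ ⌊√n⌋`" — a
`ΣΠ^{[c₀√n]}ΣΠ^{[√n]}` expression of top fan-in `s` (product gates of smaller fan-in are padded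
with `Q = 1`); conclusion `2^{ε√n} ≤ s` for `n ≥ n₀`, with `ε, n₀` depending on the field and on
`c₀`. Nothing asserted.

## References

* A. Gupta, P. Kamath, N. Kayal, R. Saptharishi, *Approaching the chasm at depth four*, J. ACM 61
  (2014), no. 6, Art. 33, Thm. 1 (CCC 2013).
* N. Kayal, C. Saha, R. Saptharishi, *A super-polynomial lower bound for regular arithmetic
  formulas*, STOC 2014 (the `n^{Ω(√n)}` improvement).
-/

noncomputable section

open MvPolynomial

namespace Literature.Computability.AlgebraicComplexity

/-- `f` has a **`ΣΠ^{[D]}ΣΠ^{[t]}` expression of top fan-in `s`**: `f = Σ_{i<s} ∏_{j<D} Q i j` with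
all `deg (Q i j) ≤ t`. [Gupta–Kamath–Kayal–Saptharishi 2014, §1 (`ΣΠ^{[D]}ΣΠ^{[t]}` circuits)] [cite: GuptaKamathKayalSaptharishi2014, §1] -/
def HasSPSPExpr {k : Type*} [CommSemiring k] {σ : Type*} (f : MvPolynomial σ k) (s D t : ℕ) : Prop :=
  ∃ Q : Fin s → Fin D → MvPolynomial σ k,
    (∀ i j, (Q i j).totalDegree ≤ t) ∧ f = ∑ i, ∏ j, Q i j

/-- NAMED FACT (**Gupta–Kamath–Kayal–Saptharishi 2014, Thm. 1**): over any field of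
characteristic `0` and for every top-product-fan-in constant `c₀` there are `ε > 0` and `n₀` such
that for all `n ≥ n₀`: if `per_n` or `det_n` has a `ΣΠ^{[c₀⌊√n⌋]}ΣΠ^{[⌊√n⌋]}` expression of top
fan-in `s`, then `2^{ε√n} ≤ s`. Users take `(h : gkks_depth4)`.
[Gupta–Kamath–Kayal–Saptharishi 2014, Thm. 1] [cite: GuptaKamathKayalSaptharishi2014, Thm. 1] -/
def gkks_depth4 : Prop :=
  ∀ (k : Type) [Field k] [CharZero k] (c₀ : ℕ), ∃ (ε : ℝ) (n₀ : ℕ), 0 < ε ∧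
    ∀ n : ℕ, n₀ ≤ n → ∀ s : ℕ,
      (HasSPSPExpr (perPoly (Fin n) k) s (c₀ * Nat.sqrt n) (Nat.sqrt n) ∨
        HasSPSPExpr (detPoly (Fin n) k) s (c₀ * Nat.sqrt n) (Nat.sqrt n)) →
        (2 : ℝ) ^ (ε * Real.sqrt n) ≤ s

/-! ### API -/

/-- A single product `∏_{j<D} Q j` is a `ΣΠΣΠ` expression of top fan-in `1`. [folklore] -/
theorem hasSPSPExpr_prod {k : Type*} [CommSemiring k] {σ : Type*} {D t : ℕ}
    (Q : Fin D → MvPolynomial σ k) (hQ : ∀ j, (Q j).totalDegree ≤ t) :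
    HasSPSPExpr (∏ j, Q j) 1 D t :=
  ⟨fun _ => Q, fun _ j => hQ j, by simp⟩

/-- The permanent case in the shape used by the route: no small `ΣΠ^{[c₀√n]}ΣΠ^{[√n]}`
expressions of `per_n` for large `n`. [Gupta–Kamath–Kayal–Saptharishi 2014, Thm. 1] [folklore] -/
theorem gkks_perPoly (h : gkks_depth4) (k : Type) [Field k] [CharZero k] (c₀ : ℕ) :
    ∃ (ε : ℝ) (n₀ : ℕ), 0 < ε ∧ ∀ n : ℕ, n₀ ≤ n → ∀ s : ℕ,
      HasSPSPExpr (perPoly (Fin n) k) s (c₀ * Nat.sqrt n) (Nat.sqrt n) → (2 : ℝ) ^ (ε * Real.sqrt n) ≤ s := by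
  obtain ⟨ε, n₀, hε, hn⟩ := h k c₀
  exact ⟨ε, n₀, hε, fun n hn' s hs => hn n hn' s (Or.inl hs)⟩

end Literature.Computability.AlgebraicComplexity
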